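import Literature.AnabelianGeometry.EtaleTheta.TemperedFrobenioidProps
import Literature.AnabelianGeometry.EtaleTheta.TemperedFrobenioidToy
import Literature.AlgebraicGeometry.Frobenioids.PiNatMonoid
import Literature.AlgebraicGeometry.Frobenioids.ModelFrobenioidUnits
import Literature.AlgebraicGeometry.Frobenioids.PadicFrobenioidQpSplit
import HarnessLib

/-!
# [EtTh] Cor. 3.8: "`Ψ` preserves the base-field-theoretic morphisms" is NOT a property of the typed
# hypothesis record `Cor38Hyp` — two tempered-Frobenioid structures on ONE category (kernel certificate)

S. Mochizuki, *The étale theta function and its Frobenioid-theoretic manifestations*, Publ. RIMS **45**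
(2009) [MochizukiEtTh2009], §3: Definition 3.6 (i)/(ii)/(iv) (PDF pp. 76–78) and Corollary 3.8 (i)–(iii)
(pp. 80–81): "(i) Suppose … the base category `D_i` of `C_i` is Frobenius-slim. Then `Ψ` preserves the
base-field-theoretic morphisms." [cite: MochizukiEtTh2009, Cor 3.8 p.80]

abc-iut cell, block F (FACT-LIST fact-proving wave), seat abc-iut-f-015; rows **F-0580**
`PreservesBaseFieldTheoretic`, **F-0740** `Cor38_i`, **F-0742** `Cor38_iii` of abc-iut-L2-t3's
`TemperedFrobenioidProps.lean` (class `preparatory`, kernel_closedness `parametrised` — the parameter is a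
record `h : Cor38Hyp C₁ C₂` = an ARBITRARY equivalence `Ψ : C₁ ≌ C₂` of the underlying categories + "`D_i` of
FSMFF-type" + "`Φ_i` non-dilating"; in `Cor38_i` moreover a FREE predicate `IsFrobeniusSlim` on categories).

What the kernel certifies here.  The typed predicate "base-field-theoretic" (Def. 3.6 (iv),
`TemperedFrobenioid.IsBaseFieldTheoretic`: "zero divisor in `Φ^{bs-fld} = Φ ∩ ℝ·Φ₀^cnst`") is read off the
Def. 3.6 (i) datum `ℝ·Φ₀^cnst` (`RealifiedDivisorMonoids.cnstR`), whereas the CATEGORY of a tempered Frobenioid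
(`TemperedFrobenioid.category` = the model Frobenioid of `(D, Φ, B, B → Φ^gp)`, [FrdI] Thm. 5.2 (i)) does not
involve that datum.  Over the trivial [FrdI] vocabularies of `TemperedFrobenioidToy.lean` we build, for
`j ∈ {0, 1}`, Def. 3.3 (iii)/3.6 (i)/3.6 (ii) data `TwoPrimes.C j` with the SAME `D = D₀ =` one object,
`Φ = Φ^{ℝ-log} = ℤ_{≥0}² = ⟨e₀, e₁⟩` (L1's `PiNat`), `B = B₀^Λ = (ℤ_{≥0}²)^gp`, `Div_B = id`, but
`ℝ·Φ₀^cnst := {g | g_j = 0}` (and `F₀^Λ :=` the same subgroup, `F₀ := 1`), so that `Φ^{bs-fld} = ℤ_{≥0}·e_{1-j}`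
IS monoprime and Def. 3.6 (ii)(b) holds (the constant `e_{1-j}` has the nonzero divisor `e_{1-j}`) — every
typed field is satisfied for both `j`.  Then:

* `TwoPrimes.category_eq` — `(C 0).category` and `(C 1).category` are the same category (`rfl`), so the
  identity is an equivalence `TwoPrimes.idEquiv : (C 1).category ≌ (C 0).category` and
  `TwoPrimes.hyp : Cor38Hyp (C 1) (C 0)` (one-object base of FSM-, hence FSMFF-type — abc-iut-L1-t4's
  `PadicFrd.isOfFSMType_discretePUnit`; "non-dilating" reads `True` in the trivial vocabulary);
* the base-identity endomorphism `φ = (1, id, e₀, (e₀, e₀))` of `(A, 0)` is base-field-theoretic for `C 1`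
  (`e₀ ∈ ℤ_{≥0}·e₀`) and NOT for `C 0` (`TwoPrimes.isBaseFieldTheoretic_φ`, `not_isBaseFieldTheoretic_φ`);
* hence **`TwoPrimes.not_preservesBaseFieldTheoretic : ¬ PreservesBaseFieldTheoretic hyp`**, the universal
  closures of F-0580 and (with `IsFrobeniusSlim := ⊤`) of F-0740 are FALSE
  (`not_forall_preservesBaseFieldTheoretic`, `not_forall_cor38_i`), and F-0742 `Cor38_iii hyp` holds only
  vacuously here (`cor38_iii_hyp`).

Reading (cell vocabulary, R5): the rows are admissible ONLY as their instance forms — abc-iut-L2's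
`Cor38Hyp.preservesBaseFieldTheoretic_of_rows` / `cor38_i_of_rows` (`TemperedFrobenioidCor38Sub.lean`, modulo
the sub-DAG rows that carry print's use of Prop. 3.4 (ii), Thm. 3.7 (iii) and the slimness of `D_i`, proof of
Cor. 3.8 p. 81), `cor38_iii_of` / `cor38_iii_of_isOfFSMType` (`Discharge/Sec3Cor38iii(FSM).lean`), and the
identity instances `TemperedFrobenioid.preservesBaseFieldTheoretic_refl` etc. (`Discharge/Sec3PropsSchemaClosures.lean`).
The gap exhibited is a SCHEMA gap of OUR typed interfaces (`Cor38Hyp` does not tie `ℝ·Φ₀^cnst` to the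
category; print determines the constants from the curve), in the line of abc-iut-w5-d135's
`TemperedFrobenioidToyFinv.lean` and abc-iut-w5-d124's `Discharge/Sec3Cor38CriterionToy.lean`; it is not a
claim about the tempered Frobenioids of a curve or about Cor. 3.8 as printed.  HONEST FRAMING: refereed
pre-IUT material; nothing here bears on the disputed [IUTchIII] Cor. 3.12; no side taken.
-/

noncomputable section

namespace Literature.AnabelianGeometry.EtaleTheta

open CategoryTheory Opposite Literature.AlgebraicGeometry.Frobenioids

namespace TwoPrimes

/-! ### §1 The monoid `ℤ_{≥0}² = ⟨e₀, e₁⟩` and the coordinate characters -/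

/-- The divisor monoid `ℤ_{≥0}²` (multiplicative notation; L1 `PiNat`). [cite: MochizukiEtTh2009, Def 3.3 p.73] -/
abbrev M : Type := Multiplicative (Fin 2 → ℕ)

/-- The two primes `e₀, e₁`. [cite: MochizukiEtTh2009, Def 3.3 p.73] -/
def e (j : Fin 2) : M := PiNat.single j 1

/-- `e_j ≠ 0`. [cite: MochizukiEtTh2009, Def 3.3 p.73] -/
theorem e_ne_one (j : Fin 2) : e j ≠ 1 := fun h => by
  have := congrArg (fun f : M => PiNat.coeff f j) h
  simp [e] at this

/-- The `j`-th coordinate character `f ↦ f_j` of `ℤ_{≥0}²`, valued in `ℤ`. [cite: MochizukiEtTh2009, Def 3.6 p.76] -/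
def χ (j : Fin 2) : M →* Multiplicative ℤ :=
  ((Nat.castAddMonoidHom ℤ).comp (Pi.evalAddMonoidHom (fun _ : Fin 2 => ℕ) j)).toMultiplicative

/-- `χ_j` on a coordinate vector. [cite: MochizukiEtTh2009, Def 3.6 p.76] -/
theorem χ_apply (j : Fin 2) (f : M) : χ j f = Multiplicative.ofAdd ((PiNat.coeff f j : ℕ) : ℤ) := rfl

/-- `χ_j(e_i) = δ_{ij}` (additively). [cite: MochizukiEtTh2009, Def 3.6 p.76] -/
theorem χ_e (i j : Fin 2) : χ j (e i) = Multiplicative.ofAdd (if i = j then (1 : ℤ) else 0) := by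
  rw [χ_apply, e]
  by_cases h : i = j
  · subst h
    simp [PiNat.coeff_single_same]
  · simp [PiNat.coeff_single_of_ne (Ne.symm h), h]

/-- The coordinate character on the groupification `(ℤ_{≥0}²)^gp → ℤ`. [cite: MochizukiEtTh2009, Def 3.6 p.76] -/
def ψ (j : Fin 2) : Algebra.GrothendieckGroup M →* Multiplicative ℤ := Algebra.GrothendieckGroup.lift (χ j)

/-- `ψ_j` extends `χ_j`. [cite: MochizukiEtTh2009, Def 3.6 p.76] -/
theorem ψ_of (j : Fin 2) (f : M) : ψ j (Algebra.GrothendieckGroup.of f) = χ j f := by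
  have h := Algebra.GrothendieckGroup.lift.symm_apply_apply (χ j)
  rw [Algebra.GrothendieckGroup.lift_symm_apply] at h
  exact DFunLike.congr_fun h f

/-- `ψ_j(e_i) = δ_{ij}`. [cite: MochizukiEtTh2009, Def 3.6 p.76] -/
theorem ψ_of_e (i j : Fin 2) :
    ψ j (Algebra.GrothendieckGroup.of (e i)) = Multiplicative.ofAdd (if i = j then (1 : ℤ) else 0) := by
  rw [ψ_of, χ_e]

/-- `gpMap id = id`, pointwise. [folklore] -/
private theorem gpMap_id_apply {N : Type} [CommMonoid N] (x : Algebra.GrothendieckGroup N) :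
    gpMap (MonoidHom.id N) x = x :=
  DFunLike.congr_fun (Literature.AlgebraicGeometry.Frobenioids.gpMap_id (M := N)) x

/-! ### §2 The typed data: Def. 3.3 (iii), Def. 3.6 (i) with `ℝ·Φ₀^cnst := {g | g_j = 0}`, Def. 3.6 (ii) -/

/-- Def. 3.3 (iii) data shared by both structures: `Φ₀ = ℤ_{≥0}²`, `B₀ = (ℤ_{≥0}²)^gp`, `div₀ = id`, `F₀ = 1`,
nothing cuspidal, over the one-object base category. [cite: MochizukiEtTh2009, Def 3.3 p.73] -/
def divisorMonoids : DivisorMonoids.{0, 0, 0} (Discrete PUnit.{1}) where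
  Φ₀ := (Functor.const _).obj (CommMonCat.of M)
  B₀ := (Functor.const _).obj (CommMonCat.of (Algebra.GrothendieckGroup M))
  isUnit_B₀ _ b := by
    change IsUnit (M := Algebra.GrothendieckGroup M) b
    exact Group.isUnit _
  div₀ _ := MonoidHom.id _
  div₀_natural _ b := (gpMap_id_apply b).symm
  F₀ _ := ⊥
  F₀_map _ _ hb := by
    rw [Submonoid.mem_bot] at hb ⊢
    rw [hb, map_one]
  ncsp₀ _ := ⊤
  csp₀ _ := ⊥
  ncsp₀_map _ _ _ := trivial
  csp₀_map _ x hx := by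
    rw [Submonoid.mem_bot] at hx ⊢
    rw [hx, map_one]
  existsUnique_ncsp_csp _ x := by
    refine ⟨(⟨x, trivial⟩, ⟨1, Submonoid.mem_bot.mpr rfl⟩), mul_one x, ?_⟩
    rintro ⟨a, c⟩ h
    have hc : c.1 = 1 := Submonoid.mem_bot.mp c.2
    have ha : a.1 = x := by
      have h' : a.1 * c.1 = x := h
      rwa [hc, mul_one] at h'
    exact Prod.ext (Subtype.ext ha) (Subtype.ext hc)

/-- Def. 3.6 (i) data (`Λ = ℤ`, `Φ₀^ℝ = Φ₀`, `B₀^Λ = B₀ = (ℤ_{≥0}²)^gp`, `Div = id`) with the constant locus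
`ℝ·Φ₀^cnst := Ker(ψ_j) = {g | g_j = 0}` and `F₀^Λ :=` the same subgroup — a root-closed subgroup containing the
divisors of `F₀^Λ` and of `F₀ = 1`, as the typed fields demand. [cite: MochizukiEtTh2009, Def 3.6 p.76] -/
def realified (j : Fin 2) : RealifiedDivisorMonoids (D₀ := Discrete PUnit.{1}) Toy.monoidVocab where
  toDivisorMonoids := divisorMonoids
  Λ := MonoidType.Z
  ΦR := (Functor.const _).obj (CommMonCat.of M)
  toR _ := MonoidHom.id _
  toR_natural _ _ := rfl
  isRealification _ := trivial
  BΛ := (Functor.const _).obj (CommMonCat.of (Algebra.GrothendieckGroup M))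
  isUnit_BΛ _ b := by
    change IsUnit (M := Algebra.GrothendieckGroup M) b
    exact Group.isUnit _
  divΛ _ := MonoidHom.id _
  divΛ_natural _ b := (gpMap_id_apply b).symm
  FΛ _ := (ψ j).ker.toSubmonoid
  FΛ_map _ _ hb := hb
  cnstR _ := (ψ j).ker
  cnstR_map _ x hx := by
    show ψ j (gpMap (MonoidHom.id M) x) = 1
    rw [gpMap_id_apply]
    exact hx
  divΛ_mem_cnstR _ _ hb := hb
  cnstR_root _ g n hg := by
    have hg' : ψ j g ^ (n : ℕ) = 1 := by rw [← map_pow]; exact hg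
    have h : (n : ℕ) • Multiplicative.toAdd (ψ j g) = 0 := by
      have := congrArg Multiplicative.toAdd hg'
      rwa [toAdd_pow, toAdd_one] at this
    show ψ j g = 1
    rcases smul_eq_zero.mp h with h | h
    · exact absurd h n.ne_zero
    · exact congrArg Multiplicative.ofAdd h
  cnst_le_cnstR _ b hb := by
    have hb' : b = 1 := Submonoid.mem_bot.mp hb
    subst hb'
    show ψ j (gpMap (MonoidHom.id M) (MonoidHom.id _ 1)) = 1
    rw [map_one, map_one, map_one]
  ncspR _ := ⊤
  cspR _ := ⊥
  toR_ncsp _ _ _ := trivial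
  toR_csp _ _ hx := hx

/-- In `Fin 2`, `rev j` is the other index. [folklore] -/
private theorem rev_ne (j : Fin 2) : j.rev ≠ j := by fin_cases j <;> decide

/-- In `Fin 2`, an index different from `rev j` is `j`. [folklore] -/
private theorem eq_of_ne_rev : ∀ (i j : Fin 2), i ≠ j.rev → i = j := by decide

/-- The base-field-theoretic submonoid `{f | f_j = 0}` of `ℤ_{≥0}²` is `ℤ_{≥0}·e_{1-j} ≅ ℤ_{≥0}`: the
isomorphism `f ↦ f_{1-j}`. [cite: MochizukiEtTh2009, Def 3.6 p.77] -/
def bsFldEquiv (j : Fin 2) :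
    ↥((⊤ : Submonoid M) ⊓ ((ψ j).ker).toSubmonoid.comap Algebra.GrothendieckGroup.of) ≃* Multiplicative ℕ where
  toFun f := Multiplicative.ofAdd (PiNat.coeff f.1 j.rev)
  invFun k := ⟨PiNat.single j.rev (Multiplicative.toAdd k), Submonoid.mem_top _, by
    change Algebra.GrothendieckGroup.of (PiNat.single j.rev (Multiplicative.toAdd k) : M) ∈ (ψ j).ker
    rw [MonoidHom.mem_ker, ψ_of, χ_apply, PiNat.coeff_single_of_ne (rev_ne j).symm]
    rfl⟩
  left_inv f := by
    obtain ⟨f, -, hf⟩ := f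
    apply Subtype.ext
    change (PiNat.single j.rev (PiNat.coeff f j.rev) : M) = f
    have hf' : ψ j (Algebra.GrothendieckGroup.of f) = 1 := hf
    rw [ψ_of, χ_apply] at hf'
    have hj : PiNat.coeff f j = 0 := by
      have := Multiplicative.ofAdd.injective hf'
      exact_mod_cast this
    exact (PiNat.eq_single_of_coeff_eq_zero fun i hi => (eq_of_ne_rev i j hi) ▸ hj).symm
  right_inv k := by simp
  map_mul' f g := by
    change Multiplicative.ofAdd (PiNat.coeff (f.1 * g.1) j.rev) = _
    rw [PiNat.coeff_mul, ofAdd_add]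

/-- **The typed tempered-Frobenioid interface is satisfied** for both `j`: `D = D₀` one object,
`Φ = Φ^{ℝ-log} = ℤ_{≥0}²` (group-saturated), `Φ^{bs-fld} = ℤ_{≥0}·e_{1-j}` monoprime (REAL `IsMonoprime`), and
Def. 3.6 (ii)(b): the constant `e_{1-j} ∈ F₀^Λ` has the nonzero divisor `e_{1-j}/1`.
[cite: MochizukiEtTh2009, Def 3.6 p.77] -/
def C (j : Fin 2) : TemperedFrobenioid (realified j) (Discrete PUnit.{1}) Toy.catVocab where
  isConnected := zigzag_isConnected fun j₁ j₂ => by rw [Subsingleton.elim j₁ j₂]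
  isTotallyEpimorphic := ⟨fun f => ⟨fun _ _ _ => Subsingleton.elim _ _⟩⟩
  base := 𝟭 _
  Φ := ⟨fun _ => ⊤, fun _ _ _ => trivial⟩
  isGroupSaturated A := (isGroupSaturated_iff' _).2 fun _ _ _ _ _ _ => trivial
  isPerfFactorial _ := trivial
  isDivisorialOn := trivial
  isMonoprime_bsFld _ := IsMonoprime.ofZ ⟨⟨bsFldEquiv j⟩⟩
  exists_FΛ_div_ne _ := ⟨Algebra.GrothendieckGroup.of (e j.rev), by
      show ψ j (Algebra.GrothendieckGroup.of (e j.rev)) = 1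
      rw [ψ_of_e, if_neg (rev_ne j)]
      rfl,
    e j.rev, trivial, 1, trivial, e_ne_one _, by rw [map_one, div_one]; rfl⟩

/-! ### §3 One category, two structures -/

/-- **The two structures have literally the same underlying category** (the model Frobenioid of
`(D, Φ, B, B → Φ^gp)` does not involve `ℝ·Φ₀^cnst`, `F₀^Λ`, `F₀`). [cite: MochizukiEtTh2009, Def 3.6 p.77] -/
theorem category_eq : (C 0).category = (C 1).category := rfl

/-- The identity functor as an equivalence `C₁ ≌ C₂` between the two structures' categories.
[cite: MochizukiEtTh2009, Cor 3.8 p.80] -/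
def idEquiv : (C 1).category ≌ (C 0).category := CategoryTheory.Equivalence.refl

/-- **The standing hypotheses of Cor. 3.8 hold** for `C₁ := C 1`, `C₂ := C 0`, `Ψ := id`: both bases are the
one-object category (of FSM-, hence FSMFF-type) and "non-dilating" reads `True` in the trivial vocabulary.
[cite: MochizukiEtTh2009, Cor 3.8 p.80] -/
def hyp : Cor38Hyp (C 1) (C 0) where
  Ψ := idEquiv
  fsmff := ⟨PadicFrd.isOfFSMType_discretePUnit.isOfFSMFFType, PadicFrd.isOfFSMType_discretePUnit.isOfFSMFFType⟩
  nonDilating := ⟨fun _ _ => trivial, fun _ _ => trivial⟩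

/-- The object `(A, 0)` of the common category. [cite: MochizukiEtTh2009, Def 3.6 p.77] -/
def X : (C 1).category := ⟨⟨⟨⟩⟩, 1⟩

/-- The rational function `(e₀, e₀) ∈ B(A) = B₀^Λ ×_{(Φ^{ℝ-log})^gp} Φ^gp` with divisor `e₀`.
[cite: MochizukiEtTh2009, Def 3.6 p.77] -/
def unit₀ : (C 1).ratFnFunctor.obj (op ⟨⟨⟩⟩) :=
  ⟨(Algebra.GrothendieckGroup.of (e 0),
    Algebra.GrothendieckGroup.of (M := (C 1).divisorMonoid.obj (op ⟨⟨⟩⟩)) ⟨e 0, trivial⟩), by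
    show (realified 1).divΛ _ (Algebra.GrothendieckGroup.of (e 0)) =
      gpMap ((C 1).Φ.carrier (op ⟨⟨⟩⟩)).subtype
        (Algebra.GrothendieckGroup.of (M := (C 1).divisorMonoid.obj (op ⟨⟨⟩⟩)) ⟨e 0, trivial⟩)
    exact (gpMap_of ((C 1).Φ.carrier (op ⟨⟨⟩⟩)).subtype ⟨e 0, trivial⟩).symm⟩

/-- The base-identity endomorphism `φ = (1, id, e₀, (e₀, e₀))` of `(A, 0)` — zero divisor `e₀`.
[cite: MochizukiEtTh2009, Def 3.6 p.78] -/
def φ : X ⟶ X := ModelFrobenioid.unitEnd X ⟨e 0, trivial⟩ unit₀ rfl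

/-- `φ` IS base-field-theoretic for the structure `C 1` (`e₀ ∈ Φ^{bs-fld} = ℤ_{≥0}·e₀`, i.e. `(e₀)_1 = 0`).
[cite: MochizukiEtTh2009, Def 3.6 p.78] -/
theorem isBaseFieldTheoretic_φ : (C 1).IsBaseFieldTheoretic φ := by
  refine ⟨trivial, ?_⟩
  show ψ 1 (Algebra.GrothendieckGroup.of (e 0)) = 1
  rw [ψ_of_e, if_neg (by decide)]
  rfl

/-- `φ` is NOT base-field-theoretic for the structure `C 0` (`(e₀)_0 = 1 ≠ 0`).
[cite: MochizukiEtTh2009, Def 3.6 p.78] -/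
theorem not_isBaseFieldTheoretic_φ : ¬ (C 0).IsBaseFieldTheoretic (hyp.Ψ.functor.map φ) := by
  intro h
  have h1 : (e 0 : M) ∈ (⊤ : Submonoid M) ∧ Algebra.GrothendieckGroup.of (e 0) ∈ (ψ 0).ker := h
  have h2 : ψ 0 (Algebra.GrothendieckGroup.of (e 0)) = 1 := h1.2
  rw [ψ_of_e, if_pos rfl] at h2
  exact one_ne_zero (Multiplicative.ofAdd.injective h2)

/-! ### §4 The rows F-0580, F-0740, F-0742 at `hyp` -/

/-- **`Ψ = id : C 1 ⥲ C 0` does NOT preserve the base-field-theoretic morphisms** although every typed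
hypothesis of Cor. 3.8 holds: F-0580 fails at `hyp`. [cite: MochizukiEtTh2009, Cor 3.8 p.80] -/
theorem not_preservesBaseFieldTheoretic : ¬ PreservesBaseFieldTheoretic hyp :=
  fun hP => not_isBaseFieldTheoretic_φ ((hP φ).1 isBaseFieldTheoretic_φ)

/-- **F-0580 as typed is not a fact over ALL `Cor38Hyp` records:** the closure (universe level `0`) is FALSE.
Instance forms: `Cor38Hyp.preservesBaseFieldTheoretic_of_rows` (conditional on the sub-DAG rows),
`TemperedFrobenioid.preservesBaseFieldTheoretic_refl`. [cite: MochizukiEtTh2009, Cor 3.8 p.80] -/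
theorem not_forall_preservesBaseFieldTheoretic :
    ¬ ∀ {D₀ : Type} [Category.{0} D₀] {V : FrdIMonoidStub.{0}} {T : RealifiedDivisorMonoids (D₀ := D₀) V}
        {D : Type} [Category.{0} D] {VD : FrdICatStub.{0, 0, 0} D}
        {D₀' : Type} [Category.{0} D₀'] {T' : RealifiedDivisorMonoids (D₀ := D₀') V}
        {D' : Type} [Category.{0} D'] {VD' : FrdICatStub.{0, 0, 0} D'}
        {C₁ : TemperedFrobenioid T D VD} {C₂ : TemperedFrobenioid T' D' VD'} (h : Cor38Hyp C₁ C₂),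
        PreservesBaseFieldTheoretic h :=
  fun h => not_preservesBaseFieldTheoretic (h hyp)

/-- **F-0740 fails at `hyp` for the tautological reading of "Frobenius-slim"** (the predicate is a FREE
parameter of the typed row). [cite: MochizukiEtTh2009, Cor 3.8 p.80] -/
theorem not_cor38_i : ¬ Cor38_i (fun _ _ => True) hyp :=
  fun h => not_preservesBaseFieldTheoretic (h trivial trivial)

/-- **F-0740 as typed is not a fact over ALL `(IsFrobeniusSlim, Cor38Hyp)`:** the closure (universe level `0`)
is FALSE.  Instance forms: `Cor38Hyp.cor38_i_of_rows` (conditional), `TemperedFrobenioid.cor38_i_refl`.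
[cite: MochizukiEtTh2009, Cor 3.8 p.80] -/
theorem not_forall_cor38_i :
    ¬ ∀ {D₀ : Type} [Category.{0} D₀] {V : FrdIMonoidStub.{0}} {T : RealifiedDivisorMonoids (D₀ := D₀) V}
        {D : Type} [Category.{0} D] {VD : FrdICatStub.{0, 0, 0} D}
        {D₀' : Type} [Category.{0} D₀'] {T' : RealifiedDivisorMonoids (D₀ := D₀') V}
        {D' : Type} [Category.{0} D'] {VD' : FrdICatStub.{0, 0, 0} D'}
        {C₁ : TemperedFrobenioid T D VD} {C₂ : TemperedFrobenioid T' D' VD'}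
        (IsFrobeniusSlim : ∀ (E : Type) [Category.{0} E], Prop) (h : Cor38Hyp C₁ C₂),
        Cor38_i IsFrobeniusSlim h :=
  fun h => not_cor38_i (h _ hyp)

/-- **F-0742 at `hyp` holds only VACUOUSLY** (its antecedent "`Ψ` preserves the base-field-theoretic
morphisms" fails); the contentful instance forms are `cor38_iii_of`, `cor38_iii_of_isOfFSMType`,
`TemperedFrobenioid.cor38_iii_refl`. [cite: MochizukiEtTh2009, Cor 3.8 p.81] -/
theorem cor38_iii_hyp : Cor38_iii hyp :=
  fun hP => (not_preservesBaseFieldTheoretic @hP).elim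

end TwoPrimes

end Literature.AnabelianGeometry.EtaleTheta

end
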